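import Literature.NumberTheory.Irrationality.Dupont2018.CubeIntegrals
import Literature.Analysis.SpecialFunctions.SelbergIntegralBasic
import HarnessLib

/-!
# Beukers–Ball–Rivoal cube integrals as hypergeometric series (Stage 1 of the discharge of
# `Dupont2018.corollary_5_6`)

Topic `Literature/NumberTheory/Irrationality/Dupont2018`. For integers `n ≥ 1`, `N ≥ 0`,
`uᵢ, vᵢ ≥ 1` with `v₁ + ⋯ + vₙ ≥ N + 1`, the cube integral of `CubeIntegrals.lean`,
`I = ∫_{[0,1]ⁿ} ∏ᵢ xᵢ^{uᵢ−1}(1−xᵢ)^{vᵢ−1} / (1 − x₁⋯xₙ)^N dx`, is absolutely convergent and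
equals the (absolutely convergent) hypergeometric series
`Σ_{m ≥ 0} C(N+m−1, m) · ∏ᵢ (uᵢ+m−1)!(vᵢ−1)!/(uᵢ+vᵢ+m−1)!`
obtained by expanding `(1 − P)^{−N} = Σ_m C(N+m−1,m) P^m` (`P = x₁⋯xₙ`) and integrating termwise
(each term is a product of Euler Beta integrals). This is the classical mechanism of
[Rivoal2000CRAS, Lemme 2] ("cette égalité s'obtient en développant en série entière … l'interversion des
signes somme et intégrale étant alors justifiée") and of Beukers' integrals [Dupont2018OddZeta, §1.1,
§5.2]; it is the first step of an elementary (hypergeometric) proof of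
[Dupont2018OddZeta, Corollary 5.6], whose printed proof is motivic (Theorems 5.1/5.5 there) — the
deviation is deliberate: the series side is where the tree's partial-fraction and parity machinery
(`CressonFischlerRivoal2008.theoreme1_holds`) lives.

Main results (all PROVED, no named facts):
* `integral_Icc_pow_mul_one_sub_pow` — `∫₀¹ x^a(1−x)^b dx = a! b!/(a+b+1)!` (`a b : ℕ`);
* `setIntegral_cube_prod_pow` — the term integrals over the cube factor into Beta integrals;
* `hasSum_cubeIntegrand` — the pointwise expansion on the half-open cube;
* `cubeTerm_le` / `summable_cubeTerm` — the majorant `C(N+m−1,m)∏ᵢBᵢ(m) ≤ K/(m+1)²`;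
* `integrableOn_cubeIntegrand`, `hasSum_cubeIntegral`, `cubeIntegral_eq_tsum` — the statement.

HONEST FRAMING (cell pub-zeta5): systematic search; no irrationality claim unless certified. Nothing in
this file concerns irrationality; it is an identity between a convergent integral and a convergent series.
-/

noncomputable section

open MeasureTheory Real Finset Set Filter
open scoped Nat Topology

namespace Literature.NumberTheory.Irrationality.Dupont2018

open Literature.Analysis.SpecialFunctions

/-! ### One-dimensional Beta integrals with natural exponents -/

/-- Euler's Beta integral with natural exponents: `∫_{[0,1]} x^a (1−x)^b dx = a!·b!/(a+b+1)!`.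
[cite: Dupont2018OddZeta, §1.1 (Beukers' integrals); Rivoal2000CRAS, Lemme 2 (mechanism)] -/
theorem integral_Icc_pow_mul_one_sub_pow (a b : ℕ) :
    ∫ x in Icc (0 : ℝ) 1, x ^ a * (1 - x) ^ b = (a ! : ℝ) * (b ! : ℝ) / ((a + b + 1)! : ℝ) := by
  have h := Selberg.integral_Icc_rpow_mul_one_sub_rpow (a := (a : ℝ) + 1) (b := (b : ℝ) + 1)
    (by positivity) (by positivity)
  simp only [add_sub_cancel_right, Real.rpow_natCast] at h
  rw [h, show (a : ℝ) + 1 + ((b : ℝ) + 1) = ((a + b + 1 : ℕ) : ℝ) + 1 by push_cast; ring,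
    Real.Gamma_nat_eq_factorial, Real.Gamma_nat_eq_factorial, Real.Gamma_nat_eq_factorial]

/-- The Beta integrand with natural exponents is integrable on `[0,1]`. [cite: Dupont2018OddZeta, §1.1] -/
theorem integrableOn_Icc_pow_mul_one_sub_pow (a b : ℕ) :
    IntegrableOn (fun x : ℝ => x ^ a * (1 - x) ^ b) (Icc 0 1) :=
  (by fun_prop : Continuous fun x : ℝ => x ^ a * (1 - x) ^ b).continuousOn.integrableOn_compact
    isCompact_Icc

/-! ### The term integrals over the cube -/

/-- The cube of `CubeIntegrals.lean` is the Selberg cube of `SelbergIntegralBasic.lean`.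
[cite: Dupont2018OddZeta, §1.1 eq. (1.2)] -/
theorem unitCube_eq_cube (n : ℕ) : unitCube n = Selberg.cube n := rfl

/-- Fubini for a product integrand over the cube: `∫_{[0,1]ⁿ} ∏ᵢ gᵢ(xᵢ) dx = ∏ᵢ ∫₀¹ gᵢ`.
[cite: Dupont2018OddZeta, §5.2 (Beukers–Ball–Rivoal integrals); Rivoal2000CRAS, Lemme 2] -/
theorem setIntegral_cube_prod (n : ℕ) (g : Fin n → ℝ → ℝ) :
    ∫ x in unitCube n, ∏ i, g i (x i) = ∏ i, ∫ t in Icc (0 : ℝ) 1, g i t := by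
  rw [unitCube_eq_cube, show (∫ x in Selberg.cube n, ∏ i, g i (x i)) =
      ∫ x, ∏ i, g i (x i) ∂((volume : Measure (Fin n → ℝ)).restrict (Selberg.cube n)) from rfl,
    Selberg.volume_restrict_cube, MeasureTheory.integral_fintype_prod_eq_prod]

/-- The `m`-th term integral: `∫_{[0,1]ⁿ} ∏ᵢ xᵢ^{uᵢ−1+m}(1−xᵢ)^{vᵢ−1} dx = ∏ᵢ (uᵢ+m−1)!(vᵢ−1)!/(uᵢ+vᵢ+m−1)!`
for `uᵢ, vᵢ ≥ 1`. [cite: Dupont2018OddZeta, §5.2; Rivoal2000CRAS, Lemme 2] -/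
theorem setIntegral_cube_prod_pow {n : ℕ} (u v : Fin n → ℕ) (hu : ∀ i, 1 ≤ u i) (hv : ∀ i, 1 ≤ v i)
    (m : ℕ) :
    ∫ x in unitCube n, ∏ i, x i ^ (u i - 1 + m) * (1 - x i) ^ (v i - 1) =
      ∏ i, ((u i + m - 1)! : ℝ) * ((v i - 1)! : ℝ) / ((u i + v i + m - 1)! : ℝ) := by
  rw [setIntegral_cube_prod n fun i t => t ^ (u i - 1 + m) * (1 - t) ^ (v i - 1)]
  refine Finset.prod_congr rfl fun i _ => ?_
  have h1 := hu i
  have h2 := hv i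
  have e1 : u i - 1 + m = u i + m - 1 := by omega
  have e2 : u i + m - 1 + (v i - 1) + 1 = u i + v i + m - 1 := by omega
  rw [integral_Icc_pow_mul_one_sub_pow, e1, e2]


/-! ### The terms of the series and the pointwise expansion -/

/-- The `m`-th term of the hypergeometric series: `C(N+m−1,m)·∏ᵢ (uᵢ+m−1)!(vᵢ−1)!/(uᵢ+vᵢ+m−1)!`.
[cite: Dupont2018OddZeta, Corollary 5.6 (the linear forms of §5.2); Rivoal2000CRAS, Lemme 2] -/
def cubeTerm (n N : ℕ) (u v : Fin n → ℕ) (m : ℕ) : ℝ :=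
  ((N + m - 1).choose m : ℝ) * ∏ i, ((u i + m - 1)! : ℝ) * ((v i - 1)! : ℝ) / ((u i + v i + m - 1)! : ℝ)

/-- The `m`-th term of the expanded integrand: `C(N+m−1,m)·∏ᵢ xᵢ^{uᵢ−1+m}(1−xᵢ)^{vᵢ−1}`.
[cite: Rivoal2000CRAS, Lemme 2 (expansion of the integrand in a power series)] -/
def cubeTermFun (n N : ℕ) (u v : Fin n → ℕ) (m : ℕ) (x : Fin n → ℝ) : ℝ :=
  ((N + m - 1).choose m : ℝ) * ∏ i, (x i ^ (u i - 1 + m) * (1 - x i) ^ (v i - 1))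

/-- The half-open cube `[0,1)ⁿ`, on which `x₁⋯xₙ < 1` and the expansion holds pointwise.
[cite: Rivoal2000CRAS, Lemme 2] -/
def halfOpenCube (n : ℕ) : Set (Fin n → ℝ) := Set.pi Set.univ fun _ : Fin n => Set.Ico (0 : ℝ) 1

/-- `[0,1)ⁿ` and `[0,1]ⁿ` agree up to a Lebesgue-null set. [cite: Rivoal2000CRAS, Lemme 2] -/
theorem halfOpenCube_ae_eq (n : ℕ) :
    halfOpenCube n =ᵐ[(volume : Measure (Fin n → ℝ))] unitCube n := by
  rw [halfOpenCube, unitCube, volume_pi]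
  exact Measure.pi_Ico_ae_eq_pi_Icc (f := fun _ => (0 : ℝ)) (g := fun _ => (1 : ℝ))

/-- `[0,1)ⁿ` is measurable. [cite: Rivoal2000CRAS, Lemme 2] -/
theorem measurableSet_halfOpenCube (n : ℕ) : MeasurableSet (halfOpenCube n) :=
  MeasurableSet.univ_pi fun _ => measurableSet_Ico

/-- `[0,1)ⁿ ⊆ [0,1]ⁿ`. [cite: Rivoal2000CRAS, Lemme 2] -/
theorem halfOpenCube_subset (n : ℕ) : halfOpenCube n ⊆ unitCube n :=
  Set.pi_mono fun _ _ => Set.Ico_subset_Icc_self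

/-- On `[0,1)ⁿ` with `n ≥ 1`: `0 ≤ x₁⋯xₙ < 1`. [cite: Rivoal2000CRAS, Lemme 2] -/
theorem prod_nonneg_lt_one_of_mem {n : ℕ} (hn : 1 ≤ n) {x : Fin n → ℝ} (hx : x ∈ halfOpenCube n) :
    0 ≤ ∏ i, x i ∧ ∏ i, x i < 1 := by
  have hx' : ∀ i, 0 ≤ x i ∧ x i < 1 := fun i => by
    simpa [halfOpenCube, Set.mem_univ_pi] using (Set.mem_univ_pi.1 hx) i
  refine ⟨Finset.prod_nonneg fun i _ => (hx' i).1, ?_⟩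
  set i₀ : Fin n := ⟨0, hn⟩
  rw [← Finset.mul_prod_erase Finset.univ x (Finset.mem_univ i₀)]
  have h1 : ∏ i ∈ Finset.univ.erase i₀, x i ≤ 1 :=
    Finset.prod_le_one (fun i _ => (hx' i).1) fun i _ => (hx' i).2.le
  have h0 : 0 ≤ ∏ i ∈ Finset.univ.erase i₀, x i := Finset.prod_nonneg fun i _ => (hx' i).1
  calc x i₀ * ∏ i ∈ Finset.univ.erase i₀, x i ≤ x i₀ * 1 :=
        mul_le_mul_of_nonneg_left h1 (hx' i₀).1
    _ < 1 := by rw [mul_one]; exact (hx' i₀).2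

/-- The expansion of the integrand on `[0,1)ⁿ`:
`∏ᵢxᵢ^{uᵢ−1}(1−xᵢ)^{vᵢ−1}/(1−P)^N = Σ_m C(N+m−1,m) ∏ᵢ xᵢ^{uᵢ−1+m}(1−xᵢ)^{vᵢ−1}`, `P = x₁⋯xₙ`.
[cite: Rivoal2000CRAS, Lemme 2 ("en développant en série entière … la fraction sous le signe intégral")] -/
theorem hasSum_cubeIntegrand {n : ℕ} (hn : 1 ≤ n) (N : ℕ) (u v : Fin n → ℕ) {x : Fin n → ℝ}
    (hx : x ∈ halfOpenCube n) :
    HasSum (fun m => cubeTermFun n N u v m x) (cubeIntegrand n N u v x) := by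
  obtain ⟨hP0, hP1⟩ := prod_nonneg_lt_one_of_mem hn hx
  set P : ℝ := ∏ i, x i with hP
  set body : ℝ := ∏ i, x i ^ (u i - 1) * (1 - x i) ^ (v i - 1) with hbody
  -- termwise identity
  have hterm : ∀ m : ℕ, cubeTermFun n N u v m x =
      body * (((N + m - 1).choose m : ℝ) * P ^ m) := by
    intro m
    rw [cubeTermFun, hbody, hP, ← Finset.prod_pow, mul_left_comm, ← Finset.prod_mul_distrib]
    congr 1
    refine Finset.prod_congr rfl fun i _ => ?_
    rw [pow_add]; ring
  have hval : cubeIntegrand n N u v x = body * (1 / (1 - P) ^ N) := by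
    rw [cubeIntegrand, ← hbody, ← hP, div_eq_mul_one_div]
  simp_rw [hterm, hval]
  refine HasSum.mul_left body ?_
  rcases Nat.eq_zero_or_pos N with hN | hN
  · -- `N = 0`: only the `m = 0` term survives
    subst hN
    have hf : (fun m : ℕ => ((0 + m - 1).choose m : ℝ) * P ^ m) = fun m => if m = 0 then 1 else 0 := by
      funext m
      rcases Nat.eq_zero_or_pos m with hm | hm
      · subst hm; simp
      · rw [if_neg hm.ne', Nat.choose_eq_zero_of_lt (by omega)]; simp
    rw [hf, pow_zero, div_one]
    exact hasSum_ite_eq 0 1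
  · -- `N = k + 1`: the negative binomial series
    obtain ⟨k, rfl⟩ : ∃ k, N = k + 1 := ⟨N - 1, by omega⟩
    have hr : ‖P‖ < 1 := by rw [Real.norm_of_nonneg hP0]; exact hP1
    have hf : (fun m : ℕ => ((k + 1 + m - 1).choose m : ℝ) * P ^ m) =
        fun m => ((m + k).choose k : ℝ) * P ^ m := by
      funext m; rw [show k + 1 + m - 1 = m + k by omega, Nat.choose_symm_add]
    rw [hf]
    exact hasSum_choose_mul_geometric_of_norm_lt_one k hr

/-! ### Measurability, continuity, nonnegativity -/

/-- The term functions are continuous. [cite: Rivoal2000CRAS, Lemme 2] -/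
theorem continuous_cubeTermFun (n N : ℕ) (u v : Fin n → ℕ) (m : ℕ) :
    Continuous (cubeTermFun n N u v m) := by
  unfold cubeTermFun; fun_prop

/-- The integrand is measurable. [cite: Dupont2018OddZeta, Corollary 5.6] -/
theorem measurable_cubeIntegrand (n N : ℕ) (u v : Fin n → ℕ) :
    Measurable (cubeIntegrand n N u v) := by
  have h1 : Continuous fun x : Fin n → ℝ => ∏ i, x i ^ (u i - 1) * (1 - x i) ^ (v i - 1) := by
    fun_prop
  have h2 : Continuous fun x : Fin n → ℝ => (1 - ∏ i, x i) ^ N := by fun_prop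
  exact h1.measurable.div h2.measurable

/-- The term functions are nonnegative on the closed cube. [cite: Rivoal2000CRAS, Lemme 2] -/
theorem cubeTermFun_nonneg {n : ℕ} (N : ℕ) (u v : Fin n → ℕ) (m : ℕ) {x : Fin n → ℝ}
    (hx : x ∈ unitCube n) : 0 ≤ cubeTermFun n N u v m x := by
  have hx' : ∀ i, 0 ≤ x i ∧ x i ≤ 1 := fun i => by
    simpa [unitCube, Set.mem_univ_pi] using (Set.mem_univ_pi.1 hx) i
  unfold cubeTermFun
  refine mul_nonneg (Nat.cast_nonneg _) (Finset.prod_nonneg fun i _ => ?_)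
  exact mul_nonneg (pow_nonneg (hx' i).1 _) (pow_nonneg (by linarith [(hx' i).2]) _)

/-- The integrand is nonnegative on the half-open cube. [cite: Rivoal2000CRAS, Lemme 2] -/
theorem cubeIntegrand_nonneg {n : ℕ} (hn : 1 ≤ n) (N : ℕ) (u v : Fin n → ℕ) {x : Fin n → ℝ}
    (hx : x ∈ halfOpenCube n) : 0 ≤ cubeIntegrand n N u v x :=
  (hasSum_cubeIntegrand hn N u v hx).nonneg fun m =>
    cubeTermFun_nonneg N u v m (halfOpenCube_subset n hx)

/-! ### The term integrals -/

/-- The term functions are integrable on the cube. [cite: Rivoal2000CRAS, Lemme 2] -/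
theorem integrableOn_cubeTermFun (n N : ℕ) (u v : Fin n → ℕ) (m : ℕ) :
    IntegrableOn (cubeTermFun n N u v m) (unitCube n) :=
  (continuous_cubeTermFun n N u v m).continuousOn.integrableOn_compact (Selberg.isCompact_cube n)

/-- `∫_{[0,1]ⁿ}` of the `m`-th term function is the `m`-th term of the series.
[cite: Rivoal2000CRAS, Lemme 2; Dupont2018OddZeta, §5.2] -/
theorem setIntegral_cubeTermFun {n : ℕ} (N : ℕ) {u v : Fin n → ℕ} (hu : ∀ i, 1 ≤ u i)
    (hv : ∀ i, 1 ≤ v i) (m : ℕ) :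
    ∫ x in unitCube n, cubeTermFun n N u v m x = cubeTerm n N u v m := by
  unfold cubeTermFun cubeTerm
  rw [integral_const_mul, setIntegral_cube_prod_pow u v hu hv m]


/-! ### The majorant `C(N+m−1,m)∏ᵢBᵢ(m) ≤ K/(m+1)²` and summability -/

/-- One Beta factor is at most `(v−1)!/(m+1)^v` when `u ≥ 1`. [cite: Rivoal2000CRAS, Lemme 2 (convergence)] -/
theorem betaFactor_le {u : ℕ} (v : ℕ) (hu : 1 ≤ u) (m : ℕ) :
    ((u + m - 1)! : ℝ) * ((v - 1)! : ℝ) / ((u + v + m - 1)! : ℝ) ≤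
      ((v - 1)! : ℝ) / ((m + 1 : ℕ) : ℝ) ^ v := by
  have h1 : (u + m - 1)! * (u + m) ^ v ≤ (u + m - 1 + v)! := by
    have := @Nat.factorial_mul_pow_le_factorial (u + m - 1) v
    rwa [show u + m - 1 + 1 = u + m by omega] at this
  have h2 : (m + 1) ^ v ≤ (u + m) ^ v := Nat.pow_le_pow_left (by omega) v
  have h3 : (u + m - 1)! * (m + 1) ^ v ≤ (u + v + m - 1)! := by
    calc (u + m - 1)! * (m + 1) ^ v ≤ (u + m - 1)! * (u + m) ^ v := Nat.mul_le_mul_left _ h2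
      _ ≤ (u + m - 1 + v)! := h1
      _ = (u + v + m - 1)! := by rw [show u + m - 1 + v = u + v + m - 1 by omega]
  have key : ((u + m - 1)! : ℝ) * ((m + 1 : ℕ) : ℝ) ^ v ≤ ((u + v + m - 1)! : ℝ) := by
    exact_mod_cast h3
  rw [div_le_div_iff₀ (by positivity) (by positivity)]
  calc ((u + m - 1)! : ℝ) * ((v - 1)! : ℝ) * (((m + 1 : ℕ) : ℝ) ^ v)
      = (((u + m - 1)! : ℝ) * ((m + 1 : ℕ) : ℝ) ^ v) * ((v - 1)! : ℝ) := by ring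
    _ ≤ ((u + v + m - 1)! : ℝ) * ((v - 1)! : ℝ) := mul_le_mul_of_nonneg_right key (by positivity)
    _ = ((v - 1)! : ℝ) * ((u + v + m - 1)! : ℝ) := by ring

/-- The binomial factor: `C(N+m−1, m) ≤ N^N·(m+1)^{N−1}`. [cite: Rivoal2000CRAS, Lemme 2 (convergence)] -/
theorem choose_le_pow_mul_pow (N m : ℕ) :
    (((N + m - 1).choose m : ℕ) : ℝ) ≤ (N : ℝ) ^ N * ((m + 1 : ℕ) : ℝ) ^ (N - 1) := by
  rcases Nat.eq_zero_or_pos N with hN | hN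
  · subst hN
    rcases Nat.eq_zero_or_pos m with hm | hm
    · subst hm; simp
    · rw [Nat.choose_eq_zero_of_lt (by omega)]; simp
  · obtain ⟨k, rfl⟩ : ∃ k, N = k + 1 := ⟨N - 1, by omega⟩
    have h1 : (k + 1 + m - 1).choose m ≤ (k + 1) ^ (k + 1) * (m + 1) ^ k := by
      rw [show k + 1 + m - 1 = k + m by omega, ← Nat.choose_symm_add]
      calc (k + m).choose k ≤ (k + m) ^ k := Nat.choose_le_pow _ _
        _ ≤ ((k + 1) * (m + 1)) ^ k := Nat.pow_le_pow_left (by nlinarith) k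
        _ = (k + 1) ^ k * (m + 1) ^ k := Nat.mul_pow _ _ _
        _ ≤ (k + 1) ^ (k + 1) * (m + 1) ^ k :=
            Nat.mul_le_mul_right _ (Nat.pow_le_pow_right (by omega) (by omega))
    rw [show k + 1 - 1 = k by omega]
    exact_mod_cast h1

/-- The terms are nonnegative. [cite: Rivoal2000CRAS, Lemme 2] -/
theorem cubeTerm_nonneg (n N : ℕ) (u v : Fin n → ℕ) (m : ℕ) : 0 ≤ cubeTerm n N u v m := by
  unfold cubeTerm
  exact mul_nonneg (Nat.cast_nonneg _) (Finset.prod_nonneg fun i _ => by positivity)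

/-- The majorant: `cubeTerm m ≤ N^N·∏ᵢ(vᵢ−1)! / (m+1)²` when `uᵢ ≥ 1` and `Σvᵢ ≥ N+1`.
[cite: Rivoal2000CRAS, Lemme 2 (convergence); Dupont2018OddZeta, Corollary 5.6 ("absolutely convergent")] -/
theorem cubeTerm_le {n N : ℕ} {u v : Fin n → ℕ} (hu : ∀ i, 1 ≤ u i) (hN : N + 1 ≤ ∑ i, v i) (m : ℕ) :
    cubeTerm n N u v m ≤ ((N : ℝ) ^ N * ∏ i, ((v i - 1)! : ℝ)) / ((m + 1 : ℕ) : ℝ) ^ 2 := by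
  set M : ℝ := ((m + 1 : ℕ) : ℝ) with hM
  have hM1 : 1 ≤ M := by rw [hM]; exact_mod_cast Nat.le_add_left 1 m
  have hM0 : 0 < M := lt_of_lt_of_le one_pos hM1
  set F : ℝ := ∏ i, ((v i - 1)! : ℝ) with hF
  have hF0 : 0 ≤ F := Finset.prod_nonneg fun i _ => by positivity
  -- the product of the Beta factors
  have hprod : ∏ i, ((u i + m - 1)! : ℝ) * ((v i - 1)! : ℝ) / ((u i + v i + m - 1)! : ℝ) ≤ F / M ^ (∑ i, v i) := by
    calc ∏ i, ((u i + m - 1)! : ℝ) * ((v i - 1)! : ℝ) / ((u i + v i + m - 1)! : ℝ)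
        ≤ ∏ i, ((v i - 1)! : ℝ) / M ^ v i :=
          Finset.prod_le_prod (fun i _ => by positivity) fun i _ => betaFactor_le (v i) (hu i) m
      _ = F / M ^ (∑ i, v i) := by
          rw [Finset.prod_div_distrib, Finset.prod_pow_eq_pow_sum]
  -- the binomial factor
  have hchoose := choose_le_pow_mul_pow N m
  rcases Nat.eq_zero_or_pos N with hN0 | hNpos
  · -- `N = 0`: only `m = 0` carries a non-zero term
    subst hN0
    rcases Nat.eq_zero_or_pos m with hm | hm
    · subst hm
      have hM1' : M = 1 := by rw [hM]; norm_num
      rw [hM1', one_pow, div_one] at hprod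
      calc cubeTerm n 0 u v 0
          = ∏ i, ((u i + 0 - 1)! : ℝ) * ((v i - 1)! : ℝ) / ((u i + v i + 0 - 1)! : ℝ) := by
            simp [cubeTerm]
        _ ≤ F := hprod
        _ = (((0 : ℕ) : ℝ) ^ 0 * F) / M ^ 2 := by rw [hM1']; simp
    · have hc : (0 + m - 1).choose m = 0 := Nat.choose_eq_zero_of_lt (by omega)
      have h0 : cubeTerm n 0 u v m = 0 := by rw [cubeTerm, hc]; simp
      rw [h0]; positivity
  · -- `N ≥ 1`
    have hNV : N - 1 + 2 ≤ ∑ i, v i := by omega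
    have hpow : M ^ (N - 1) / M ^ (∑ i, v i) ≤ 1 / M ^ 2 := by
      rw [div_le_div_iff₀ (by positivity) (by positivity), one_mul, ← pow_add]
      exact pow_le_pow_right₀ hM1 hNV
    calc cubeTerm n N u v m
        = (((N + m - 1).choose m : ℕ) : ℝ) *
            ∏ i, ((u i + m - 1)! : ℝ) * ((v i - 1)! : ℝ) / ((u i + v i + m - 1)! : ℝ) := rfl
      _ ≤ ((N : ℝ) ^ N * M ^ (N - 1)) * (F / M ^ (∑ i, v i)) :=
          mul_le_mul hchoose hprod (Finset.prod_nonneg fun i _ => by positivity) (by positivity)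
      _ = (N : ℝ) ^ N * F * (M ^ (N - 1) / M ^ (∑ i, v i)) := by ring
      _ ≤ (N : ℝ) ^ N * F * (1 / M ^ 2) := mul_le_mul_of_nonneg_left hpow (by positivity)
      _ = (N : ℝ) ^ N * F / M ^ 2 := by ring

/-- The series `Σ_m cubeTerm m` converges absolutely when `uᵢ ≥ 1` and `Σvᵢ ≥ N + 1`.
[cite: Dupont2018OddZeta, Corollary 5.6; Rivoal2000CRAS, Lemme 2] -/
theorem summable_cubeTerm {n N : ℕ} {u v : Fin n → ℕ} (hu : ∀ i, 1 ≤ u i) (hN : N + 1 ≤ ∑ i, v i) :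
    Summable (cubeTerm n N u v) := by
  have h0 : Summable fun m : ℕ => 1 / ((m : ℕ) : ℝ) ^ 2 := Real.summable_one_div_nat_pow.mpr one_lt_two
  have h1 : Summable fun m : ℕ => 1 / ((m + 1 : ℕ) : ℝ) ^ 2 := h0.comp_injective (add_left_injective 1)
  have h2 : Summable fun m : ℕ => ((N : ℝ) ^ N * ∏ i, ((v i - 1)! : ℝ)) / ((m + 1 : ℕ) : ℝ) ^ 2 := by
    have := h1.mul_left ((N : ℝ) ^ N * ∏ i, ((v i - 1)! : ℝ))
    refine this.congr fun m => ?_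
    ring
  exact Summable.of_nonneg_of_le (cubeTerm_nonneg n N u v) (cubeTerm_le hu hN) h2


/-! ### The cube integral equals the series -/

/-- **Beukers–Ball–Rivoal cube integrals as hypergeometric series.** For `n ≥ 1`, `uᵢ, vᵢ ≥ 1` and
`v₁ + ⋯ + vₙ ≥ N + 1`, the integral `∫_{[0,1]ⁿ} ∏ᵢ xᵢ^{uᵢ−1}(1−xᵢ)^{vᵢ−1}/(1−x₁⋯xₙ)^N dx` converges
absolutely and `Σ_m C(N+m−1,m)∏ᵢ(uᵢ+m−1)!(vᵢ−1)!/(uᵢ+vᵢ+m−1)!` sums to it.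
[cite: Rivoal2000CRAS, Lemme 2 (power-series expansion of the integrand and termwise integration);
Dupont2018OddZeta, Corollary 5.6 ("absolutely convergent")] -/
theorem integrableOn_and_hasSum_cubeIntegral {n N : ℕ} {u v : Fin n → ℕ} (hn : 1 ≤ n)
    (hu : ∀ i, 1 ≤ u i) (hv : ∀ i, 1 ≤ v i) (hN : N + 1 ≤ ∑ i, v i) :
    IntegrableOn (cubeIntegrand n N u v) (unitCube n) ∧
      HasSum (cubeTerm n N u v) (cubeIntegral n N u v) := by
  set μ' : Measure (Fin n → ℝ) := (volume : Measure (Fin n → ℝ)).restrict (halfOpenCube n) with hμ'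
  have hS := measurableSet_halfOpenCube n
  -- the terms, with respect to `μ'`
  have hFint : ∀ m, Integrable (cubeTermFun n N u v m) μ' := fun m =>
    (integrableOn_cubeTermFun n N u v m).mono_set (halfOpenCube_subset n)
  have hFnn : ∀ m, 0 ≤ᵐ[μ'] cubeTermFun n N u v m := fun m =>
    ae_restrict_of_forall_mem hS fun x hx => cubeTermFun_nonneg N u v m (halfOpenCube_subset n hx)
  have hFval : ∀ m, ∫ x, cubeTermFun n N u v m x ∂μ' = cubeTerm n N u v m := fun m => by
    rw [hμ', setIntegral_congr_set (halfOpenCube_ae_eq n), setIntegral_cubeTermFun N hu hv m]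
  have hFnorm : ∀ m, ∫ x, ‖cubeTermFun n N u v m x‖ ∂μ' = cubeTerm n N u v m := fun m => by
    rw [← hFval m]
    refine integral_congr_ae ?_
    filter_upwards [hFnn m] with x hx using Real.norm_of_nonneg hx
  have hsumT : Summable (cubeTerm n N u v) := summable_cubeTerm hu hN
  have hsum : Summable fun m => ∫ x, ‖cubeTermFun n N u v m x‖ ∂μ' :=
    (funext hFnorm ▸ hsumT :)
  -- the pointwise expansion on `[0,1)ⁿ`
  have hpt : ∀ x ∈ halfOpenCube n, cubeIntegrand n N u v x = ∑' m, cubeTermFun n N u v m x :=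
    fun x hx => ((hasSum_cubeIntegrand hn N u v hx).tsum_eq).symm
  -- the value of the integral
  have hI : cubeIntegral n N u v = ∑' m, cubeTerm n N u v m := by
    calc cubeIntegral n N u v = ∫ x in halfOpenCube n, cubeIntegrand n N u v x := by
          rw [cubeIntegral, setIntegral_congr_set (halfOpenCube_ae_eq n).symm]
      _ = ∫ x in halfOpenCube n, ∑' m, cubeTermFun n N u v m x := setIntegral_congr_fun hS hpt
      _ = ∑' m, ∫ x, cubeTermFun n N u v m x ∂μ' :=
          (integral_tsum_of_summable_integral_norm hFint hsum).symm
      _ = ∑' m, cubeTerm n N u v m := tsum_congr hFval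
  refine ⟨?_, by rw [hI]; exact hsumT.hasSum⟩
  -- integrability: compute the lower integral of the (nonnegative) integrand on `[0,1)ⁿ`
  have hmeas : Measurable (cubeIntegrand n N u v) := measurable_cubeIntegrand n N u v
  have hnn : 0 ≤ᵐ[μ'] cubeIntegrand n N u v :=
    ae_restrict_of_forall_mem hS fun x hx => cubeIntegrand_nonneg hn N u v hx
  have hlin : ∫⁻ x, ENNReal.ofReal (cubeIntegrand n N u v x) ∂μ' =
      ENNReal.ofReal (∑' m, cubeTerm n N u v m) := by
    calc ∫⁻ x, ENNReal.ofReal (cubeIntegrand n N u v x) ∂μ'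
        = ∫⁻ x, ∑' m, ENNReal.ofReal (cubeTermFun n N u v m x) ∂μ' := by
          refine lintegral_congr_ae (ae_restrict_of_forall_mem hS fun x hx => ?_)
          show ENNReal.ofReal (cubeIntegrand n N u v x) = ∑' m, ENNReal.ofReal (cubeTermFun n N u v m x)
          rw [hpt x hx]
          exact ENNReal.ofReal_tsum_of_nonneg
            (fun m => cubeTermFun_nonneg N u v m (halfOpenCube_subset n hx))
            (hasSum_cubeIntegrand hn N u v hx).summable
      _ = ∑' m, ∫⁻ x, ENNReal.ofReal (cubeTermFun n N u v m x) ∂μ' :=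
          lintegral_tsum fun m =>
            ((continuous_cubeTermFun n N u v m).measurable.ennreal_ofReal).aemeasurable
      _ = ∑' m, ENNReal.ofReal (∫ x, cubeTermFun n N u v m x ∂μ') :=
          tsum_congr fun m => (ofReal_integral_eq_lintegral_ofReal (hFint m) (hFnn m)).symm
      _ = ∑' m, ENNReal.ofReal (cubeTerm n N u v m) := tsum_congr fun m => by rw [hFval]
      _ = ENNReal.ofReal (∑' m, cubeTerm n N u v m) :=
          (ENNReal.ofReal_tsum_of_nonneg (cubeTerm_nonneg n N u v) hsumT).symm
  have hint' : IntegrableOn (cubeIntegrand n N u v) (halfOpenCube n) volume := by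
    show Integrable (cubeIntegrand n N u v) μ'
    exact ⟨hmeas.aestronglyMeasurable,
      (hasFiniteIntegral_iff_ofReal hnn).2 (by rw [hlin]; exact ENNReal.ofReal_lt_top)⟩
  exact hint'.congr_set_ae (halfOpenCube_ae_eq n).symm

/-- The cube integrand is integrable on `[0,1]ⁿ` (`n ≥ 1`, `uᵢ, vᵢ ≥ 1`, `Σvᵢ ≥ N+1`).
[cite: Dupont2018OddZeta, Corollary 5.6 ("is absolutely convergent")] -/
theorem integrableOn_cubeIntegrand {n N : ℕ} {u v : Fin n → ℕ} (hn : 1 ≤ n)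
    (hu : ∀ i, 1 ≤ u i) (hv : ∀ i, 1 ≤ v i) (hN : N + 1 ≤ ∑ i, v i) :
    IntegrableOn (cubeIntegrand n N u v) (unitCube n) :=
  (integrableOn_and_hasSum_cubeIntegral hn hu hv hN).1

/-- `Σ_m C(N+m−1,m)∏ᵢ(uᵢ+m−1)!(vᵢ−1)!/(uᵢ+vᵢ+m−1)!` sums to the cube integral.
[cite: Rivoal2000CRAS, Lemme 2; Dupont2018OddZeta, §5.2] -/
theorem hasSum_cubeIntegral {n N : ℕ} {u v : Fin n → ℕ} (hn : 1 ≤ n)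
    (hu : ∀ i, 1 ≤ u i) (hv : ∀ i, 1 ≤ v i) (hN : N + 1 ≤ ∑ i, v i) :
    HasSum (cubeTerm n N u v) (cubeIntegral n N u v) :=
  (integrableOn_and_hasSum_cubeIntegral hn hu hv hN).2

/-- The cube integral as a series: `∫_{[0,1]ⁿ} ∏ᵢxᵢ^{uᵢ−1}(1−xᵢ)^{vᵢ−1}/(1−x₁⋯xₙ)^N dx =
Σ_m C(N+m−1,m)∏ᵢ(uᵢ+m−1)!(vᵢ−1)!/(uᵢ+vᵢ+m−1)!`. [cite: Rivoal2000CRAS, Lemme 2; Dupont2018OddZeta, §5.2] -/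
theorem cubeIntegral_eq_tsum {n N : ℕ} {u v : Fin n → ℕ} (hn : 1 ≤ n)
    (hu : ∀ i, 1 ≤ u i) (hv : ∀ i, 1 ≤ v i) (hN : N + 1 ≤ ∑ i, v i) :
    cubeIntegral n N u v = ∑' m, cubeTerm n N u v m :=
  ((hasSum_cubeIntegral hn hu hv hN).tsum_eq).symm

end Literature.NumberTheory.Irrationality.Dupont2018
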